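import Summits.ResolutionOfSingularities.ResolutionOfSingularities.Theorems.EquisingularLiftEquisingularLiftNatModelPointStep
import Summits.ResolutionOfSingularities.ResolutionOfSingularities.Theorems.HilbertSamuelEliminationSigmaMaxModificationsCorridor3StrictTransformKernel
import Literature.AlgebraicGeometry.Resolution.HypersurfaceMaxOrderTransform
import Literature.AlgebraicGeometry.Resolution.RegularBlowup
import Literature.AlgebraicGeometry.Resolution.ResolutionGlue
import Literature.AlgebraicGeometry.Resolution.OrderSemicontinuityPointwise
import Literature.AlgebraicGeometry.Resolution.PrimeDivisorIdeals
import HarnessLib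

/-!
# [OURS · L1 W4.5(b) · EL♮ kit K7d] STRICT TRANSFORMS ALONG A SECTION CENTRE: regular carrier, principal stalks,
# and equimultiplicity along the section read at the closed point

Crux `EquisingularLiftNat` = stmt-ResolutionOfSingularities-20038 (route EquisingularLift), line `sections`; helper file
`--supports … --as helper` for the HSUB(ReachTC⁺)₃ assembly of res-L1-w45b-stub-1 (brick deal 2026-08-27T11:31:42Z, row K7d:
«St_τ of a stalkwise-principal ideal sheaf along a regular section centre is stalkwise principal; St_τ 𝓢 has regular V(·)»),
in the currency of stub-1's `TCPlus.Member` clause (iii) (`strictTransformIdeal τ s.ker ·`, `(stalkIdeal · z).IsPrincipal`).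
HONEST FRAMING: OURS (cell res-hironaka, slot W4.5(b)); NOT a statement of any manuscript; AI-written, weaker than expert
review. No `sorry`; standard axioms.

CONTENT (a section `s` of a separated `r : X → Spec O`, `O` a DVR; `τ : X' → X` the blow-up of `ker s`).
* `ker_section_eq_vanishingIdeal_support` — `ker s` is the vanishing ideal sheaf of its support (it is radical: `Spec O` is
  reduced), so the tree's theorems on blow-ups of REGULAR REDUCED centres `V(𝓘(Y))` apply to `τ`.
* `isRegular_subscheme_strictTransformIdeal_of_le_ker` — for `𝓢 ≤ ker s` with `V(𝓢)` regular, `V(St_τ 𝓢)` is regular: it is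
  the blow-up of `V(𝓢)` along `V(ker s) ∩ V(𝓢) = V(ker s) ≅ Spec O` (tree `isBlowup_subscheme_strictTransformIdeal`, W4.2 helper,
  + Liu 8.1.19 `IsBlowup.isRegular_of_isRegular_subscheme`).
* `isPrincipal_stalkIdeal_strictTransformIdeal_of_section` — for `X` regular and `J` with principal stalks and CONSTANT order `μ`
  along the section, every stalk of `St_τ J` is principal (Kollár 3.60 in the tree:
  `IsBlowup.strictTransformIdeal_eq_controlledTransform_of_forall_isPrincipal` + `isPrincipal_stalkIdeal_controlledTransform`).
* `forall_idealOrder_eq_of_section` — the order hypothesis of the previous item READ AT THE CLOSED POINT: if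
  `J_p ⊆ (ker s)_p^μ` and `ord_p J = μ` at `p = s(𝔪)` (with `𝒪_{X,p}` regular) then `ord_y J = μ` at both points of the section
  (`Spec O` has two points; at the generic one `≥ μ` by `stalkIdeal_map_stalkSpecializes`, `≤ μ` by
  `idealOrder_le_of_specializes`). Call sites: `μ = 1` for the carrier divisor `𝓢` and for the cone `K` at a regular point of
  the carrier; `μ = m` for `K` at a centred point (`K_p = (Φ(c₁,c₂))`, `Φ` a form of degree `m`, `Φ ≢ 0 mod 𝔪_p`).

References: J. Kollár, *Lectures on Resolution of Singularities* (2007), 3.58–3.60; Q. Liu, *Algebraic Geometry and Arithmetic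
Curves* (2002), Thm. 8.1.19; U. Görtz, T. Wedhorn, *Algebraic Geometry I* (2020), Prop. 13.91, 13.96; V. Cossart, O. Piltant
(2008), Prop. 4.2 (orders under specialisation).
-/

set_option linter.dupNamespace false -- mandated namespace `Summit.<Summit>.<Problem>` of this single-conjunct summit
set_option linter.overlappingInstances false -- signatures carry `[IsDomain O] [IsDiscreteValuationRing O]`

noncomputable section

open CategoryTheory CategoryTheory.Limits AlgebraicGeometry TopologicalSpace Topology IsLocalRing
open Literature.AlgebraicGeometry.Resolution
open AlgebraicGeometry.Scheme.IdealSheafData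
open Summit.ResolutionOfSingularities.ResolutionOfSingularities.Theses.EquisingularLift.Split
open Summit.ResolutionOfSingularities.ResolutionOfSingularities.Cruxes.EquisingularLift.StrataSplit
open Summit.ResolutionOfSingularities.ResolutionOfSingularities.Theorems.SigmaMaxModificationsCorridor3.Helpers

namespace Summit.ResolutionOfSingularities.ResolutionOfSingularities.Cruxes.EquisingularLiftNat.Sections

/-! ## The section centre is a regular reduced centre -/

/-- **The kernel of a section is the vanishing ideal of its support.** For a section `s` of a separated `r : X → Spec O` with
`O` a domain, `ker s` is a radical ideal sheaf (`Spec O` is reduced), hence `ker s = 𝓘(supp ker s)`. [folklore] -/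
theorem ker_section_eq_vanishingIdeal_support (O : Type) [CommRing O] [IsDomain O] {X : Scheme.{0}}
    (r : X ⟶ Spec (.of O)) [IsSeparated r] (s : Spec (.of O) ⟶ X) (hs : s ≫ r = 𝟙 _) :
    s.ker = vanishingIdeal s.ker.support := by
  haveI : IsClosedImmersion (s ≫ r) := by rw [hs]; infer_instance
  haveI : IsClosedImmersion s := .of_comp s r
  have hrad : s.ker.radical = s.ker := by
    ext W : 2
    rw [Scheme.IdealSheafData.radical_ideal, Scheme.Hom.ker_apply]
    exact (Ideal.isRadical_bot.comap (s.app W).hom).radical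
  rw [Scheme.IdealSheafData.vanishingIdeal_support, hrad]

/-! ## The strict transform of a regular carrier containing the section is regular -/

/-- **`V(St_τ 𝓢)` is regular.** Let `s` be a section of the separated `r : X → Spec O` (`O` a DVR, `X` locally Noetherian),
`𝓢 ≤ ker s` an ideal sheaf with `V(𝓢)` regular (so the section lies on the regular `V(𝓢)`), and `τ : X' → X` the blow-up
of `ker s`. Then the strict transform `V(St_τ 𝓢) = V(⋃ₙ (𝓢𝒪_{X'} : 𝓘_Eⁿ))` is regular: it is the blow-up of `V(𝓢)` along
`V(ker s) ×_X V(𝓢) = V(ker s) ≅ Spec O`, a regular centre in a regular locally Noetherian scheme.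
[cite: Liu2002, Thm. 8.1.19] [cite: GortzWedhorn2020, Prop. 13.96 (2)] -/
theorem isRegular_subscheme_strictTransformIdeal_of_le_ker (O : Type) [CommRing O] [IsDomain O]
    [IsDiscreteValuationRing O] {X X' : Scheme.{0}} [IsLocallyNoetherian X]
    (r : X ⟶ Spec (.of O)) [IsSeparated r] (s : Spec (.of O) ⟶ X) (hs : s ≫ r = 𝟙 _)
    (𝓢 : X.IdealSheafData) (h𝓢 : Scheme.IsRegular 𝓢.subscheme) (hle : 𝓢 ≤ s.ker)
    {τ : X' ⟶ X} (hτ : IsBlowup τ s.ker) :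
    Scheme.IsRegular (strictTransformIdeal τ s.ker 𝓢).subscheme := by
  obtain ⟨_, hCreg, -, -⟩ := section_isClosedImmersion_and_isRegular_ker O X r s hs
  haveI : IsLocallyNoetherian 𝓢.subscheme := LocallyOfFiniteType.isLocallyNoetherian 𝓢.subschemeι
  -- the centre restricted to `V(𝓢)` is `V(ker s)` itself
  have hcentre : Scheme.IsRegular (s.ker.comap 𝓢.subschemeι).subscheme := by
    have hk : (pullback.fst s.ker.subschemeι 𝓢.subschemeι).ker = ⊥ := by
      rw [Scheme.IdealSheafData.ker_fst_of_isClosedImmersion, Scheme.IdealSheafData.ker_subschemeι,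
        ← le_ker_iff_comap_eq_bot, Scheme.IdealSheafData.ker_subschemeι]
      exact hle
    haveI : IsIso (pullback.fst s.ker.subschemeι 𝓢.subschemeι) := IsClosedImmersion.isIso_iff_ker_eq_bot.mpr hk
    exact Scheme.IsRegular.of_iso
      (inv (pullback.fst s.ker.subschemeι 𝓢.subschemeι) ≫ (pullbackSymmetry 𝓢.subschemeι s.ker.subschemeι).inv ≫
        (s.ker.comapIso 𝓢.subschemeι).inv) hCreg
  -- `V(St 𝓢) → V(𝓢)` is the blow-up of `V(𝓢)` along that centre
  obtain ⟨ρ, hρ⟩ := exists_hom_subscheme_strictTransformIdeal τ s.ker 𝓢.subschemeι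
  have hbl := isBlowup_subscheme_strictTransformIdeal hτ 𝓢.subschemeι ρ hρ
  have hreg' : Scheme.IsRegular (strictTransformIdeal τ s.ker 𝓢.subschemeι.ker).subscheme :=
    IsBlowup.isRegular_of_isRegular_subscheme h𝓢 hcentre hbl
  rwa [Scheme.IdealSheafData.ker_subschemeι] at hreg'

/-! ## Principal stalks are kept, given equimultiplicity along the section -/

/-- **Strict transforms of hypersurfaces along a section keep principal stalks.** Let `X` be regular and locally Noetherian,
`s` a section of the separated `r : X → Spec O` (`O` a DVR), `τ : X' → X` the blow-up of `ker s` (`X'` locally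
Noetherian), and `J` an ideal sheaf with principal stalks and constant order `μ` along the section. Then every stalk of the
strict transform `St_τ J` is principal (it is the controlled transform `(J𝒪_{X'} : 𝓘_E^μ)`). [cite: Kollar2007, 3.58–3.60] -/
theorem isPrincipal_stalkIdeal_strictTransformIdeal_of_section (O : Type) [CommRing O] [IsDomain O]
    [IsDiscreteValuationRing O] {X X' : Scheme.{0}} [IsLocallyNoetherian X] [IsLocallyNoetherian X']
    (hX : Scheme.IsRegular X) (r : X ⟶ Spec (.of O)) [IsSeparated r] (s : Spec (.of O) ⟶ X) (hs : s ≫ r = 𝟙 _)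
    {τ : X' ⟶ X} (hτ : IsBlowup τ s.ker) {J : X.IdealSheafData} {μ : ℕ}
    (hY : ∀ y ∈ (s.ker.support : Set X), idealOrder J y = μ) (hJ : ∀ x, (stalkIdeal J x).IsPrincipal) (x' : X') :
    (stalkIdeal (strictTransformIdeal τ s.ker J) x').IsPrincipal := by
  obtain ⟨_, hCreg, -, -⟩ := section_isClosedImmersion_and_isRegular_ker O X r s hs
  have hker := ker_section_eq_vanishingIdeal_support O r s hs
  rw [hker] at hτ hCreg ⊢
  rw [IsBlowup.strictTransformIdeal_eq_controlledTransform_of_forall_isPrincipal hX hCreg hτ hY hJ]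
  exact IsBlowup.isPrincipal_stalkIdeal_controlledTransform hX hCreg hτ hY hJ x'

/-! ## Equimultiplicity along the section, read at the closed point -/

/-- **Orders along a section are read at the closed point.** Let `s` be a section of the separated `r : X → Spec O` (`O` a
DVR), `p = s(𝔪)` with `𝒪_{X,p}` regular, and `J` an ideal sheaf with `J_p ⊆ (ker s)_p^μ` and `ord_p J = μ`. Then
`ord_y J = μ` at every point `y` of the section: `Spec O` has exactly two points, and at the image `η` of the generic one
`J_η = J_p 𝒪_{X,η} ⊆ (ker s)_η^μ ⊆ 𝔪_η^μ` while `ord_η J ≤ ord_p J` (orders do not drop under specialisation at a regular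
point). [cite: CossartPiltant2008, Prop. 4.2 (proof)] -/
theorem forall_idealOrder_eq_of_section (O : Type) [CommRing O] [IsDomain O] [IsDiscreteValuationRing O]
    {X : Scheme.{0}} (r : X ⟶ Spec (.of O)) [IsSeparated r] (s : Spec (.of O) ⟶ X) (hs : s ≫ r = 𝟙 _)
    (hreg : IsRegularLocalRing (X.presheaf.stalk (s (closedPoint O)))) (J : X.IdealSheafData) {μ : ℕ}
    (hle : stalkIdeal J (s (closedPoint O)) ≤ stalkIdeal s.ker (s (closedPoint O)) ^ μ)
    (hp : idealOrder J (s (closedPoint O)) = μ) :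
    ∀ y ∈ (s.ker.support : Set X), idealOrder J y = μ := by
  haveI := hreg
  obtain ⟨_, -, -, hCsupp⟩ := section_isClosedImmersion_and_isRegular_ker O X r s hs
  intro y hy
  rw [hCsupp] at hy
  obtain ⟨pt, rfl⟩ := hy
  by_cases hpt : pt.asIdeal = ⊥
  · -- the generic point of `Spec O`
    have hgen : pt ⤳ closedPoint O :=
      (PrimeSpectrum.le_iff_specializes pt (closedPoint O)).mp (by
        change pt.asIdeal ≤ (closedPoint O).asIdeal
        rw [hpt]; exact bot_le)
    have hsp : s pt ⤳ s (closedPoint O) := hgen.map s.continuous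
    refine le_antisymm ?_ ?_
    · rw [← hp]
      exact idealOrder_le_of_specializes hsp J
    · rw [le_idealOrder_iff, ← stalkIdeal_map_stalkSpecializes J hsp]
      have hmem : s pt ∈ s.ker.support := by
        rw [← SetLike.mem_coe, hCsupp]; exact ⟨pt, rfl⟩
      calc (stalkIdeal J (s (closedPoint O))).map (X.presheaf.stalkSpecializes hsp).hom
          ≤ (stalkIdeal s.ker (s (closedPoint O)) ^ μ).map (X.presheaf.stalkSpecializes hsp).hom := Ideal.map_mono hle
        _ = stalkIdeal s.ker (s pt) ^ μ := by rw [Ideal.map_pow, stalkIdeal_map_stalkSpecializes]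
        _ ≤ maximalIdeal (X.presheaf.stalk (s pt)) ^ μ :=
          Ideal.pow_right_mono ((mem_support_iff_stalkIdeal_le _ _).mp hmem) μ
  · -- the closed point of `Spec O`
    have hmax : pt.asIdeal.IsMaximal := Ideal.IsPrime.isMaximal inferInstance hpt
    have hpt' : pt = closedPoint O := PrimeSpectrum.ext (IsLocalRing.eq_maximalIdeal hmax)
    rw [hpt']
    exact hp

end Summit.ResolutionOfSingularities.ResolutionOfSingularities.Cruxes.EquisingularLiftNat.Sections

end
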